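import Mathlib
import Summits.Langlands.Langlands.Theses.PicardMuOrdinary
import Literature.NumberTheory.GaloisRepresentations.CubicResidueSymbol
import Literature.NumberTheory.GaloisRepresentations.CubicJacobiSumPrimary
import Literature.NumberTheory.GaloisRepresentations.GaloisRep
import Literature.NumberTheory.GaloisRepresentations.IntegralGaloisActionProofs
import Literature.NumberTheory.GaloisRepresentations.EisensteinPrimaryHeckeCharacter
import Literature.NumberTheory.GaloisRepresentations.PrimaryGeneratorHeckeCharacter
import Literature.NumberTheory.Automorphic.ReciprocityGLn
import Summits.Langlands.Langlands.Theorems.PicardMuOrdinaryMuOrdinaryFamilyRTDictionary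
import Summits.Langlands.Langlands.Theorems.PicardMuOrdinaryIrregularClassicalityAlgebraicHeckeUntwist
import Summits.Langlands.Langlands.Theorems.PicardMuOrdinaryIrregularClassicalityIrregularDescent
import HarnessLib

/-!
# The untwist `π'_K ↦ π_K = π'_K ⊗ ψ⁻¹` of line `split-ramified-prime-sqrt6`
# (crux `IrregularClassicality`, stmt-Langlands-13758, last stub) — corrected, `K`-side form

Notation: `K = ℚ(ω) = CyclotomicField 3 ℚ`, `a_𝔭(f) = picardTrace f 𝔭`, `ϖ_𝔭` the PRIMARY
generator of `𝔭 ∤ 3` (`𝔭 = (ϖ_𝔭)`, `ϖ_𝔭 ≡ 1 mod 3`), `ψ` the algebraic Hecke character of `K` of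
conductor `(3)` with `ψ(ϖ_𝔭) = e(ϖ_𝔭)` (`exists_primaryGen_heckeCharacter_cyclotomicField_three`),
`ρ = ρ'_C = ρ_C ⊗ ψ` the twisted Picard representation through `(ι, e)`, pinned by its geometric
Frobenius traces `ι⁻¹ e(a_𝔭(f) ϖ_𝔭)` off `S₀`.

The registered stub `stub_irregularDescentUntwist` asks to DESCEND a cuspidal `L`-algebraic `π_L`
on `GL₃(𝔸_L)`, `L/K` CM quadratic, compatible with `ρ|_{Γ_L}`, to `K` and untwist.  As typed it
is not provable from the tree and the published record: after Arthur–Clozel's cyclic descent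
`π_L = BC(π₀)` the two candidates `π₀`, `π₀ ⊗ χ_{L/K}` are told apart only by the SIGN of their
Satake parameters at the primes of `K` INERT in `L` (infinitely many), and no hypothesis sees
that sign: compatibility over `L` at the place `w` above an inert `𝔭` reads
`charpoly ρ(Frob_𝔭²)`, i.e. the SQUARES of the eigenvalues, and even the central character
(`∏`) leaves `{a,b,c}` versus `{a,-b,-c}` undecided; on paper the sign comes from Galois
(pseudo-)representations attached to the IRREGULAR `π₀` (Goldring–Koskivirta on `U(2,1)`), which
the typed `IsLAlgebraic π_L` cannot feed.  What IS provable now, unconditionally, is the untwist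
over `K`; this file proves the stub in the corrected `K`-side currency (the lead re-registers):

* `stub_irregularDescentUntwist` (corrected signature) — from a cuspidal `L`-algebraic `π'` on
  `GL₃(𝔸_K)` compatible with `ρ` outside a finite `S'` (arithmetic-Frobenius characteristic
  polynomial `∏ (X − ι⁻¹ α_j⁻¹)`, Buzzard–Gee normalisation `m = 1`) to a cuspidal `L`-algebraic
  `π_K` with `Σ Sat(π_K, 𝔭) = e(a_𝔭 f)` for almost all `𝔭`;
* `stub_irregularUntwist_sum` — the same from the SUM form `Σ Sat(π', 𝔭) = e(a_𝔭(f) ϖ_𝔭)` a.e.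
  (no `ρ`), which is what the compatibility gives (`trace_inv_eq_of_hasFrobCharpolyAt_one`:
  `tr ρ(Frob⁻¹) = ι⁻¹(Σ α)`);
* `stub_irregularDescentUntwist_of` — the REGISTERED signature (verbatim), CONDITIONALLY on the
  tree's named facts `cuspidal_descent_cyclic`, `exists_twist_quadraticSign`,
  `ArthurClozel1989_strongLifting_archimedean`, `AutomorphicRepData.exists_hasInfinityType` and on
  the reciprocity hypothesis `H_gal` (Galois representations for the `L`-algebraic cuspidal
  representations of `GL₃(𝔸_K)`, Buzzard–Gee Conj. 3.2.1 in weak form — OPEN), through the landed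
  conditional descent `stub_irregularDescent_of` (`…IrregularClassicalityIrregularDescent`).

Proof of the untwist: primary generators are unique (a unit of `ℤ[ω]` which is `≡ 1 mod 3` is `1`,
`units_eq_one_of_sub_one_mem_span_three`), so the given `ϖ` is the `ϖ` of
`exists_primaryGen_heckeCharacter_cyclotomicField_three` off `S₀ ∪ {3}` and `ψ(ϖ_𝔭) = e(ϖ_𝔭) ≠ 0`;
twist `π'` by the ALGEBRAIC character `ψ⁻¹` (`exists_untwist_sum_eq` of the helper file
`…AlgebraicHeckeUntwist`: the twist of a cuspidal `L`-algebraic datum by an algebraic Hecke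
character is cuspidal `L`-algebraic with Satake parameters multiplied by `ψ⁻¹(ϖ_𝔭) = e(ϖ_𝔭)⁻¹`),
so `Σ Sat(π_K, 𝔭) = e(ϖ_𝔭)⁻¹ e(a_𝔭 ϖ_𝔭) = e(a_𝔭)`.
-/

open scoped Classical
open Literature.NumberTheory.GaloisRepresentations Literature.NumberTheory.Automorphic
open IsDedekindDomain NumberField Polynomial Filter

set_option linter.dupNamespace false -- project-wide option; `Summit.Langlands.Langlands` is the mandated namespace

noncomputable section

namespace Summit.Langlands.Langlands.Theorems.IrregularClassicality.SplitRamifiedPrimeSqrt6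

/-! ## Frobenius bookkeeping: `tr ρ(Frob⁻¹) = ι⁻¹(Σ α)` in the normalisation `m = 1` -/

/-- **Trace of the geometric Frobenius from an `m = 1` Satake polynomial.**  If the arithmetic
Frobenii of `ρ : Γ_K → GL_n(ℚ̄_ℓ)` at `𝔭` have characteristic polynomial
`arithFrobPolyOfSatake ι q 1 α = ∏_{a ∈ α} (X − ι⁻¹(a⁻¹))`, then for every arithmetic Frobenius
`τ` at a prime above `𝔭`, `tr ρ(τ⁻¹) = ι⁻¹(Σ α)` (the eigenvalues of the invertible `ρ(τ)` are
the `ι⁻¹(a⁻¹)`, none of them zero; `trace_inv_of_charpoly_eq_prod` of the sibling crux). -/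
theorem trace_inv_eq_of_hasFrobCharpolyAt_one {F : Type} [Field F] [NumberField F] {ℓ : ℕ}
    [Fact ℓ.Prime] {n : ℕ} (ι : PadicAlgCl ℓ ≃+* ℂ) (ρ : FramedGaloisRep F (PadicAlgCl ℓ) n)
    {𝔭 : HeightOneSpectrum (𝓞 F)} {q : ℕ} {α : Multiset ℂ}
    (h : ρ.HasFrobCharpolyAt 𝔭 (arithFrobPolyOfSatake ι q 1 α))
    {𝔓 : Ideal (absIntegers (𝓞 F) F)} (h𝔓 : 𝔓 ∈ 𝔭.primesAbove)
    {τ : Field.absoluteGaloisGroup F} (hτ : IsArithFrobAt (𝓞 F) τ 𝔓) :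
    FramedRep.trace ρ τ⁻¹ = ι.symm α.sum := by
  have hc : ((ρ τ : GL (Fin n) (PadicAlgCl ℓ)) : Matrix (Fin n) (Fin n) (PadicAlgCl ℓ)).charpoly =
      ((α.map fun a => ι.symm a⁻¹).map fun c => X - C c).prod := by
    have h1 := h 𝔓 h𝔓 τ hτ
    rw [arithFrobPolyOfSatake_one] at h1
    rw [Multiset.map_map]
    exact h1
  unfold FramedRep.trace
  rw [map_inv, Matrix.coe_units_inv,
    Cruxes.MuOrdinaryFamilyRT.CharZeroDominance.trace_inv_of_charpoly_eq_prod (Units.isUnit _) hc,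
    Multiset.map_map, map_multiset_sum]
  refine congrArg _ (Multiset.map_congr rfl fun a _ => ?_)
  simp only [Function.comp_apply, map_inv₀, inv_inv]

/-! ## Primary generators of `ℤ[ω]` are unique -/

/-- **Uniqueness of primary generators in `ℤ[ω] = 𝓞 ℚ(ω)`**: two generators of the same prime
`𝔭 ∌ 3` which are both `≡ 1 mod 3` coincide (the units `±ω^i` are pairwise incongruent modulo
`3`: `units_eq_one_of_sub_one_mem_span_three`, Ireland–Rosen Prop. 9.3.5). -/
theorem primaryGen_unique {𝔭 : HeightOneSpectrum (𝓞 (CyclotomicField 3 ℚ))}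
    (h3 : (3 : 𝓞 (CyclotomicField 3 ℚ)) ∉ 𝔭.asIdeal) {x y : 𝓞 (CyclotomicField 3 ℚ)}
    (hx : 𝔭.asIdeal = Ideal.span {x}) (hy : 𝔭.asIdeal = Ideal.span {y})
    (hx1 : x - 1 ∈ Ideal.span {(3 : 𝓞 (CyclotomicField 3 ℚ))})
    (hy1 : y - 1 ∈ Ideal.span {(3 : 𝓞 (CyclotomicField 3 ℚ))}) : x = y := by
  haveI : IsCyclotomicExtension {3} ℚ (CyclotomicField 3 ℚ) :=
    CyclotomicField.isCyclotomicExtension 3 ℚ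
  obtain ⟨ζ, hζ⟩ := exists_isPrimitiveRoot_three_cyclotomicField
  refine eq_of_span_eq_of_sub_one_mem (units_eq_one_of_sub_one_mem_span_three hζ) ?_
    (hx.symm.trans hy) hx1 hy1
  -- `(x) = 𝔭` is prime to `(3)`: `𝔭` is maximal and does not contain `3`
  rw [← hx, Ideal.isCoprime_iff_sup_eq]
  by_contra hne
  have hle : Ideal.span {(3 : 𝓞 (CyclotomicField 3 ℚ))} ≤ 𝔭.asIdeal :=
    le_sup_right.trans (𝔭.isMaximal.eq_of_le hne le_sup_left).ge
  exact h3 (hle (Ideal.mem_span_singleton_self _))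

/-! ## The untwist, sum form -/

/-- **The untwist by the CM character, in sum form.**  For `K = ℚ(ω)`, an embedding `e : K → ℂ`,
a finite `S₀ ⊇ {v ∣ 3}` and primary generators `ϖ` off `S₀` (`𝔭 = (ϖ_𝔭)`, `ϖ_𝔭 ≡ 1 mod 3`): every
cuspidal `L`-algebraic `π'` on `GL₃(𝔸_K)` with `Σ Sat(π', 𝔭) = e(a_𝔭(f) · ϖ_𝔭)` for almost all
`𝔭` untwists to a cuspidal `L`-algebraic `π_K` with `Σ Sat(π_K, 𝔭) = e(a_𝔭 f)` for almost all
`𝔭` — the twist of `π'` by the inverse of the algebraic Hecke character `ψ` of conductor `(3)`,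
`ψ(ϖ_𝔭) = e(ϖ_𝔭)` (Ireland–Rosen Ch. 18 §4; Weil 1956), whose Satake parameters are those of `π'`
multiplied by `e(ϖ_𝔭)⁻¹` (Arthur–Clozel 1989, Ch. 3 p. 172) and which stays `L`-algebraic
(Borel–Jacquet 1979, 5.7; Buzzard–Gee 2014, §3.1). -/
theorem stub_irregularUntwist_sum :
    ∀ (f : ℤ[X]) (hcpt : isCompact_glFiniteIntegralLevel 3 (CyclotomicField 3 ℚ))
      (e : CyclotomicField 3 ℚ →+* ℂ)
      (S₀ : Finset (HeightOneSpectrum (𝓞 (CyclotomicField 3 ℚ))))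
      (ϖ : HeightOneSpectrum (𝓞 (CyclotomicField 3 ℚ)) → 𝓞 (CyclotomicField 3 ℚ)),
      (∀ v : HeightOneSpectrum (𝓞 (CyclotomicField 3 ℚ)),
        ((3 : ℕ) : 𝓞 (CyclotomicField 3 ℚ)) ∈ v.asIdeal → v ∈ S₀) →
      (∀ 𝔭 ∉ S₀, 𝔭.asIdeal = Ideal.span {ϖ 𝔭} ∧
          ϖ 𝔭 - 1 ∈ Ideal.span {(3 : 𝓞 (CyclotomicField 3 ℚ))}) →
    ∀ (π' : CuspidalAutomorphicRepData 3 (CyclotomicField 3 ℚ) hcpt), π'.1.IsLAlgebraic →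
      (∀ᶠ 𝔭 : HeightOneSpectrum (𝓞 (CyclotomicField 3 ℚ)) in Filter.cofinite, ∃ α : Multiset ℂ,
        π'.1.HasSatakeParamAt 𝔭 α ∧ α.sum = e (↑(picardTrace f 𝔭 * ϖ 𝔭))) →
    ∃ πK : CuspidalAutomorphicRepData 3 (CyclotomicField 3 ℚ) hcpt, πK.1.IsLAlgebraic ∧
      ∀ᶠ 𝔭 : HeightOneSpectrum (𝓞 (CyclotomicField 3 ℚ)) in Filter.cofinite, ∃ α : Multiset ℂ,
        πK.1.HasSatakeParamAt 𝔭 α ∧ α.sum = e (picardTrace f 𝔭) := by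
  intro f hcpt e S₀ ϖ hS₀ hϖ π' hL hsum
  classical
  -- the CM character `ψ` with `ψ(ϖ'_𝔭) = e(ϖ'_𝔭)` for ITS primary generators `ϖ'`
  obtain ⟨ϖ', ψ, hψalg, hψ⟩ := exists_primaryGen_heckeCharacter_cyclotomicField_three e
  -- off `S₀`: `3 ∉ 𝔭`, `ϖ 𝔭 = ϖ' 𝔭`, `ψ(ϖ_𝔭) = e(ϖ 𝔭) ≠ 0`
  have hS₀' : ∀ᶠ 𝔭 : HeightOneSpectrum (𝓞 (CyclotomicField 3 ℚ)) in cofinite, 𝔭 ∉ S₀ := by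
    rw [eventually_cofinite]
    simpa only [not_not, Finset.setOf_mem] using S₀.finite_toSet
  have hval : ∀ 𝔭 ∉ S₀, ψ.valueAtUniformizer 𝔭 = e (ϖ 𝔭) ∧ e (ϖ 𝔭) ≠ 0 := by
    intro 𝔭 h𝔭
    have h3 : (3 : 𝓞 (CyclotomicField 3 ℚ)) ∉ 𝔭.asIdeal := fun h =>
      h𝔭 (hS₀ 𝔭 (by rwa [Nat.cast_ofNat]))
    obtain ⟨⟨hgen', h1'⟩, -, hv⟩ := hψ 𝔭 h3
    obtain ⟨hgen, h1⟩ := hϖ 𝔭 h𝔭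
    have heq : ϖ 𝔭 = ϖ' 𝔭 := primaryGen_unique h3 hgen hgen' h1 h1'
    refine ⟨by rw [hv, heq], fun h0 => ?_⟩
    have hϖ0 : ϖ 𝔭 = 0 := by
      have := (map_eq_zero e).mp h0
      exact_mod_cast this
    exact 𝔭.ne_bot (by rw [hgen, hϖ0, Ideal.span_singleton_eq_bot])
  have h0 : ∀ᶠ 𝔭 : HeightOneSpectrum (𝓞 (CyclotomicField 3 ℚ)) in cofinite,
      ψ.valueAtUniformizer 𝔭 ≠ 0 :=
    hS₀'.mono fun 𝔭 h𝔭 => by rw [(hval 𝔭 h𝔭).1]; exact (hval 𝔭 h𝔭).2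
  have h : ∀ᶠ 𝔭 : HeightOneSpectrum (𝓞 (CyclotomicField 3 ℚ)) in cofinite, ∃ α : Multiset ℂ,
      π'.1.HasSatakeParamAt 𝔭 α ∧ α.sum = e (picardTrace f 𝔭) * ψ.valueAtUniformizer 𝔭 := by
    filter_upwards [hS₀', hsum] with 𝔭 h𝔭 ⟨α, hα, hs⟩
    refine ⟨α, hα, ?_⟩
    rw [hs, (hval 𝔭 h𝔭).1, ← map_mul]
    push_cast
    rfl
  exact exists_untwist_sum_eq π' hL hψalg (fun 𝔭 => e (picardTrace f 𝔭)) h0 h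

/-! ## The corrected stub: `K`-side compatibility with `ρ` ⇒ the crux's conclusion at `e` -/

/-- **Stub `stub_irregularDescentUntwist` of line `split-ramified-prime-sqrt6`, corrected to the
`K`-side currency.**  For generic `f`, `(ι, e)`, the primary generators `ϖ` off `S₀ ⊇ {v ∣ 3}` and
the twisted Picard representation `ρ = ρ_C ⊗ ψ` with geometric Frobenius traces
`ι⁻¹ e(a_𝔭(f) ϖ_𝔭)` off `S₀`: every cuspidal `L`-algebraic `π'` on `GL₃(𝔸_K)` compatible with
`ρ` outside a finite `S'` (the arithmetic Frobenii at `𝔭` have characteristic polynomial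
`∏_j (X − ι⁻¹(α_j⁻¹))` for the Satake parameter `α` of `π'` at `𝔭`, Buzzard–Gee's `m = 1`)
untwists to a cuspidal `L`-algebraic `π_K` with `Σ Sat(π_K, 𝔭) = e(a_𝔭 f)` for almost all `𝔭`.
Proof: at `𝔭 ∉ S' ∪ S₀` an arithmetic Frobenius `τ` exists
(`exists_isArithFrobAt_of_mem_primesAbove_holds`), `ι⁻¹(Σ α) = tr ρ(τ⁻¹) = ι⁻¹ e(a_𝔭 ϖ_𝔭)`
(`trace_inv_eq_of_hasFrobCharpolyAt_one`), and `stub_irregularUntwist_sum` untwists. -/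
theorem stub_irregularDescentUntwist :
    ∀ (f : ℤ[X]) (hcpt : isCompact_glFiniteIntegralLevel 3 (CyclotomicField 3 ℚ)),
      f.natDegree = 4 → (f.map (Int.castRingHom ℚ)).Separable →
      12 ∣ Nat.card (f.map (Int.castRingHom ℚ)).Gal →
    ∀ (ι : PadicAlgCl 3 ≃+* ℂ) (e : CyclotomicField 3 ℚ →+* ℂ)
      (S₀ : Finset (HeightOneSpectrum (𝓞 (CyclotomicField 3 ℚ))))
      (ϖ : HeightOneSpectrum (𝓞 (CyclotomicField 3 ℚ)) → 𝓞 (CyclotomicField 3 ℚ))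
      (ρ : FramedGaloisRep (CyclotomicField 3 ℚ) (PadicAlgCl 3) 3),
      (∀ v : HeightOneSpectrum (𝓞 (CyclotomicField 3 ℚ)),
        ((3 : ℕ) : 𝓞 (CyclotomicField 3 ℚ)) ∈ v.asIdeal → v ∈ S₀) →
      (∀ 𝔭 ∉ S₀,
        (𝔭.asIdeal = Ideal.span {ϖ 𝔭} ∧
          ϖ 𝔭 - 1 ∈ Ideal.span {(3 : 𝓞 (CyclotomicField 3 ℚ))}) ∧
        ρ.IsUnramifiedAt 𝔭 ∧
        ∀ 𝔓 ∈ 𝔭.primesAbove, ∀ τ : Field.absoluteGaloisGroup (CyclotomicField 3 ℚ),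
          IsArithFrobAt (𝓞 (CyclotomicField 3 ℚ)) τ 𝔓 →
            FramedRep.trace ρ τ⁻¹ = ι.symm (e (↑(picardTrace f 𝔭 * ϖ 𝔭)))) →
    ∀ (π' : CuspidalAutomorphicRepData 3 (CyclotomicField 3 ℚ) hcpt)
      (S' : Finset (HeightOneSpectrum (𝓞 (CyclotomicField 3 ℚ)))),
      π'.1.IsLAlgebraic →
      (∀ 𝔭 ∉ S', ∃ α : Multiset ℂ, π'.1.HasSatakeParamAt 𝔭 α ∧
        ρ.IsUnramifiedAt 𝔭 ∧ ρ.HasFrobCharpolyAt 𝔭 (arithFrobPolyOfSatake ι 𝔭.residueCard 1 α)) →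
    ∃ πK : CuspidalAutomorphicRepData 3 (CyclotomicField 3 ℚ) hcpt, πK.1.IsLAlgebraic ∧
      ∀ᶠ 𝔭 : HeightOneSpectrum (𝓞 (CyclotomicField 3 ℚ)) in Filter.cofinite, ∃ α : Multiset ℂ,
        πK.1.HasSatakeParamAt 𝔭 α ∧ α.sum = e (picardTrace f 𝔭) := by
  intro f hcpt _ _ _ ι e S₀ ϖ ρ hS₀ hρ π' S' hL hcompat
  classical
  refine stub_irregularUntwist_sum f hcpt e S₀ ϖ hS₀ (fun 𝔭 h𝔭 => (hρ 𝔭 h𝔭).1) π' hL ?_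
  have hS : ∀ᶠ 𝔭 : HeightOneSpectrum (𝓞 (CyclotomicField 3 ℚ)) in cofinite, 𝔭 ∉ S' ∪ S₀ := by
    rw [eventually_cofinite]
    simpa only [not_not, Finset.setOf_mem] using (S' ∪ S₀).finite_toSet
  refine hS.mono fun 𝔭 h𝔭 => ?_
  rw [Finset.mem_union, not_or] at h𝔭
  obtain ⟨α, hα, -, hF⟩ := hcompat 𝔭 h𝔭.1
  refine ⟨α, hα, ι.symm.injective ?_⟩
  -- an arithmetic Frobenius `τ` at a prime `𝔓 ∣ 𝔭`
  obtain ⟨𝔓, h𝔓⟩ := HeightOneSpectrum.primesAbove_nonempty 𝔭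
  obtain ⟨τ, hτ⟩ := HeightOneSpectrum.exists_isArithFrobAt_of_mem_primesAbove_holds h𝔓
  rw [← trace_inv_eq_of_hasFrobCharpolyAt_one ι ρ hF h𝔓 hτ, (hρ 𝔭 h𝔭.2).2.2 𝔓 h𝔓 τ hτ]

/-! ## The registered stub, conditionally -/

/-- **The registered stub `stub_irregularDescentUntwist` (signature VERBATIM, lines 438–466 of the
line's skeleton), CONDITIONALLY**: from the tree's named facts `cuspidal_descent_cyclic`,
`exists_twist_quadraticSign`, `ArthurClozel1989_strongLifting_archimedean`,
`AutomorphicRepData.exists_hasInfinityType`, and the reciprocity hypothesis `H_gal` (Buzzard–Gee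
2014, Conj. 3.2.1, weak form, for the `L`-algebraic cuspidal representations of `GL₃(𝔸_K)`,
`K = ℚ(ω)`, `ℓ = 3` — OPEN; the one input of the stub that is neither proved nor a published
theorem in this generality).  Proof: `stub_irregularDescent_of` (descent `L → K` with the sign at
the inert primes decided by Clifford against the Galois representations supplied by `H_gal`) and
the unconditional untwist `stub_irregularDescentUntwist` (corrected, `K`-side form). -/
theorem stub_irregularDescentUntwist_of (hdesc : cuspidal_descent_cyclic)
    (htw : exists_twist_quadraticSign) (hArch : ArthurClozel1989_strongLifting_archimedean)
    (hInf : ∀ (N : ℕ) (M : Type) [Field M] [NumberField M] (hM : isCompact_glFiniteIntegralLevel N M)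
      (Q : AutomorphicRepData (AutomorphyDatum.gl N M hM)), Q.exists_hasInfinityType)
    (Hgal : ∀ (hcpt : isCompact_glFiniteIntegralLevel 3 (CyclotomicField 3 ℚ)) (ι : PadicAlgCl 3 ≃+* ℂ)
      (P₁ : CuspidalAutomorphicRepData 3 (CyclotomicField 3 ℚ) hcpt), P₁.1.IsLAlgebraic →
        ∃ r : FramedGaloisRep (CyclotomicField 3 ℚ) (PadicAlgCl 3) 3, r.toGaloisRep.IsSemisimple ∧
          ∀ᶠ v : HeightOneSpectrum (𝓞 (CyclotomicField 3 ℚ)) in Filter.cofinite, ∀ α : Multiset ℂ,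
            P₁.1.HasSatakeParamAt v α →
              r.IsUnramifiedAt v ∧ r.HasFrobCharpolyAt v (arithFrobPolyOfSatake ι v.residueCard 1 α)) :
    ∀ (f : ℤ[X]) (hcpt : isCompact_glFiniteIntegralLevel 3 (CyclotomicField 3 ℚ)),
      f.natDegree = 4 → (f.map (Int.castRingHom ℚ)).Separable →
      12 ∣ Nat.card (f.map (Int.castRingHom ℚ)).Gal →
    ∀ (ι : PadicAlgCl 3 ≃+* ℂ) (e : CyclotomicField 3 ℚ →+* ℂ)
      (S₀ : Finset (HeightOneSpectrum (𝓞 (CyclotomicField 3 ℚ))))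
      (ϖ : HeightOneSpectrum (𝓞 (CyclotomicField 3 ℚ)) → 𝓞 (CyclotomicField 3 ℚ))
      (ρ : FramedGaloisRep (CyclotomicField 3 ℚ) (PadicAlgCl 3) 3),
      (∀ v : HeightOneSpectrum (𝓞 (CyclotomicField 3 ℚ)),
        ((3 : ℕ) : 𝓞 (CyclotomicField 3 ℚ)) ∈ v.asIdeal → v ∈ S₀) →
      (∀ 𝔭 ∉ S₀,
        (𝔭.asIdeal = Ideal.span {ϖ 𝔭} ∧
          ϖ 𝔭 - 1 ∈ Ideal.span {(3 : 𝓞 (CyclotomicField 3 ℚ))}) ∧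
        ρ.IsUnramifiedAt 𝔭 ∧
        ∀ 𝔓 ∈ 𝔭.primesAbove, ∀ τ : Field.absoluteGaloisGroup (CyclotomicField 3 ℚ),
          IsArithFrobAt (𝓞 (CyclotomicField 3 ℚ)) τ 𝔓 →
            FramedRep.trace ρ τ⁻¹ = ι.symm (e (↑(picardTrace f 𝔭 * ϖ 𝔭)))) →
    ∀ (L : Type) [Field L] [NumberField L] [Algebra (CyclotomicField 3 ℚ) L]
      (hcptL : isCompact_glFiniteIntegralLevel 3 L),
      NumberField.IsCMField L → Module.finrank (CyclotomicField 3 ℚ) L = 2 →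
      FramedRep.IsAbsolutelyIrreducible (ρ.restrictField L) →
    ∀ (πL : CuspidalAutomorphicRepData 3 L hcptL) (S' : Finset (HeightOneSpectrum (𝓞 L))),
      πL.1.IsLAlgebraic →
      (∀ w ∉ S', ∃ β : Multiset ℂ, πL.1.HasSatakeParamAt w β ∧
        (ρ.restrictField L).IsUnramifiedAt w ∧
        (ρ.restrictField L).HasFrobCharpolyAt w (arithFrobPolyOfSatake ι w.residueCard 1 β)) →
    ∃ πK : CuspidalAutomorphicRepData 3 (CyclotomicField 3 ℚ) hcpt, πK.1.IsLAlgebraic ∧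
      ∀ᶠ 𝔭 : HeightOneSpectrum (𝓞 (CyclotomicField 3 ℚ)) in Filter.cofinite, ∃ α : Multiset ℂ,
        πK.1.HasSatakeParamAt 𝔭 α ∧ α.sum = e (picardTrace f 𝔭) := by
  intro f hcpt hdeg hsep hgal ι e S₀ ϖ ρ hS₀ hρ L _ _ _ hcptL _ hdegL hirr πL S' hLalg hcompat
  obtain ⟨π', S'', hL', hcompat'⟩ :=
    stub_irregularDescent_of hdesc htw hArch hInf hcpt ι ρ L hcptL hdegL hirr (Hgal hcpt ι) πL S'
      hLalg hcompat
  exact stub_irregularDescentUntwist f hcpt hdeg hsep hgal ι e S₀ ϖ ρ hS₀ hρ π' S'' hL' hcompat'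

end Summit.Langlands.Langlands.Theorems.IrregularClassicality.SplitRamifiedPrimeSqrt6

end
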